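import Summits.BirchSwinnertonDyer.Rank1Residual.X2.CellCBDPValueLZZRoadInputOfFact
import Summits.BirchSwinnertonDyer.BirchSwinnertonDyer.Theorems.ClassRecordThreeNormRigidityOneSided
import Summits.BirchSwinnertonDyer.BirchSwinnertonDyer.Theorems.ClassRecordThreeIMCDivAtThreeB
import Summits.BirchSwinnertonDyer.Rank1Residual.X11b.UnrIntegersValuationRing
import Summits.BirchSwinnertonDyer.Rank1Residual.X11b.PadicComplexInertiaFixed
import Summits.BirchSwinnertonDyer.Rank1Residual.X11b.CastellaErratumVersionOfRecord
import Summits.BirchSwinnertonDyer.Rank1Residual.X11b.Three.StepLHalves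
import Literature.NumberTheory.QuadraticFields.HeegnerCondition
import HarnessLib

/-!
# Route `ClassRecordThree` ∕ `KolyvaginRoadThree` (cell `bsd-stepL`), THESES-FREE KERNEL: the H2 half `Three.BDPValueAt₃ W`
# for EVERY curve with `3 ∥ N` from the REFEREED Liu–Zhang–Zhang fact, and the bodies of the re-oriented halves cruxes
# `HalvesAtThreeR` (item 20194) ∕ `HalvesTamAtThreeR` (20253) from that fact + the H3ᴮ bodies (20262 ∕ 20263) — importable by `closes`

Seat `bsd-stepL-thmc-p1` g8 (prover; the (VC₃) ∕ H2@3 lineage), 2026-08-27; `--supports stmt-BirchSwinnertonDyer-20194 --as helper`.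
WHY THIS FILE: the cross-cell supply of `bsd-eis-cgshw` g15 — `Theorems/ClassRecordThreeBDPValueLeafOfLZZ.lean` (p522944): (VN₃)
at every `W` from the typed input `X2.LZZRoadInputIoo` ∕ the REFEREED fact `LiuZhangZhang2018.thm151_thm153_modularCurve_heegnerVector`
(Duke Math. J. 167 (2018) Thm. 1.5.1 + Remark 1.1.2 ∧ Thm. 1.5.3, typed p509230), then the route leaf 19406 — and the H2 bridges
of this lineage it consumes (`bdpValueAt₃_of_normContinuity`, p429767; `bdpValueAt₃_iff_norm_constantCoeff`, p425632) all
live in modules that import the route's Theses file, so no `closes` certificate can cite them (import cycle; plan g31 GATE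
LESSONS). Here the SAME chain is written out in ONE Theses-free proof (namespace `LZZKernel`; the originals stay where they are):

* §1 **`LZZKernel.bdpValueAt₃_of_lzzRoadInputIoo (hL : X2.LZZRoadInputIoo) (W) : Three.BDPValueAt₃ W`** — ONE self-contained
  Theses-free proof (bsd-eis's rescale at the datum → display norms → one-sided norm rigidity onto the frame → unit of `R₀` by the
  valuation ring property); no intermediate lemma is re-stated (the gate's dedup rule), the cited accepted proofs are written out inline.
* §2 **`LZZKernel.bdpValueAt₃_of_thm151_thm153 (hF) (W) : Three.BDPValueAt₃ W`** — the H2 half at 3 for EVERY globally minimal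
  curve (its X11b@3 hypotheses live inside the predicate), modulo the ONE refereed fact; no image, no rank, no reducibility hypothesis.
* §3 **the BODIES of the cruxes of record**: `LZZKernel.halvesAtThreeRBody_of_thm151_thm153_of_imcDivTwoLociRBody` (= the
  unfolding of `ClassRecordThree.HalvesAtThreeR` ⟸ fact ∧ the unfolding of `IMCDivTwoLociAtThreeR`) and the KOLY Tam twin
  `LZZKernel.halvesTamAtThreeRBody_of_thm151_thm153_of_imcDivTwoLociTamRBody` (+ the input form) — Theses-free, hence citable
  inside a `closes` re-certification («h₂ derived from a by-name LZZ support item + 20262», planner's call), and one `fun … ↦`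
  away from the registered skeletons' `_of` (stub 1 := the LZZ fact by name).
* §4 (appended 2026-08-27, same seat) `bdpValueAt₃_all_of_thm151_thm153` — plan g32 RULING 18 (B)'s wanted signature verbatim
  (`∀ W, ClassX11b W 3 → Three.BDPValueAt₃ W` from the fact), one line over §2.

HONEST FRAMING: theorems only (0 defs, 0 new named facts, 0 `sorry`); every theorem is CONDITIONAL on its displayed binders
(`hL : X2.LZZRoadInputIoo` ∕ `hF : LiuZhangZhang2018.…` = a Literature named fact ⇒ `conditional-result`; `h3` = the OPEN
H3ᴮ crux body); nothing booked; no node, label or census count moves (T7); H3ᴮ (`Three.IMCDivAt₃B`) is NOT discharged;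
(VC₃) 19493 with its frame-free `R₀`-unit is NOT proved here (see the companion `ClassRecordThreeHalvesAtThreeROfLZZ.lean`:
⟸ fact ∧ Hsieh 2014 ∧ leaf 19405); BSD(E,3) is proved for no class. The fidelity of the typed LZZ fact at a Steinberg
prime `p = 3` (Assumption 1.8.1 «p split» is the paper's only standing hypothesis; readings pub/bsd-eis LIT-DOSSIER §82∕§86)
is for the referee ∕ ARM-P desk, not asserted by this file.

References: [LiuZhangZhang2018] Duke Math. J. 167 (2018) Thm. 1.5.1, Remark 1.1.2, Thm. 1.5.3, Assumption 1.8.1 (pp. 745–751);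
[Castella2018] Camb. J. Math. 6 (2018) Thms. 3.1–3.3 (shapes; value normalisation); pub/bsd-eis cgshw-MEMO-18 ∕ -19; cell memo
PROOF-BDP §20 (THEOREM C, the memo road this replaces for the kernel).
-/

set_option linter.dupNamespace false

noncomputable section

open scoped Classical Topology

open Filter WeierstrassCurve NumberField IsDedekindDomain Field PowerSeries
  Literature.NumberTheory.EllipticCurves Literature.NumberTheory.EllipticCurves.ModularForms
  Literature.NumberTheory.EllipticCurves.Rank1Residual
  Literature.NumberTheory.GaloisRepresentations Literature.NumberTheory.GaloisCohomology
  Summit.BirchSwinnertonDyer.Rank1Residual Summit.BirchSwinnertonDyer.Rank1Residual.X11b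
  Summit.BirchSwinnertonDyer.Rank1Residual.X11b.AcSelmer
  Summit.BirchSwinnertonDyer.Rank1Residual.X11b.CongruenceLimit
  Summit.BirchSwinnertonDyer.Rank1Residual.X11b.Halves
  Summit.BirchSwinnertonDyer.Rank1Residual.X11b.Three

namespace Summit.BirchSwinnertonDyer.BirchSwinnertonDyer.Theorems.LZZKernel

/-! ## §1 `Three.BDPValueAt₃ W` for EVERY curve from the typed LZZ input — one self-contained Theses-free proof -/

/-- **The H2 half `Three.BDPValueAt₃ W` for every globally minimal `W`, from the typed Liu–Zhang–Zhang input `X2.LZZRoadInputIoo`.**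
One self-contained proof (no intermediate lemma is re-stated, so nothing already landed is duplicated): at a frame
`(ι', Ω_K', Ω_p' ∈ R₀ˣ, L' ∈ R₀⟦T⟧)` of an X11b@3 classical datum, (i) bsd-eis's rescale `X2.exists_continuousDisplay_of_lzzRoadInputIoo`
(p512988; dictionary `3 ∣ N`, `9 ∤ N` ⟸ Mult, `3` split ⟸ Heegner, `d_K < −4` ⟸ `Odd d_K` ∧ `3 ∤ d_K`, `InducesPrime` verbatim,
`embAt` as the logarithm's embedding — the lines of p522944 §1) gives virtual periods `Ω_K, Ω_p` and `u ∈ ℂ₃`, `‖u‖ = 1`, with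
Castella's display tending to `u·V²`, `V = (1 − a₃·3⁻¹)·log_{ω_E} P`; (ii) taking norms, the display NORMS tend to `‖V‖² ≠ 0`
(`a₃ = ±1`, `log_{ω_E} P ≠ 0` for non-torsion `P`); (iii) one-sided norm rigidity
`intSeries_norm_constantCoeff_eq_of_isBDPLFunctionInt_of_continuousNorms` (p427664) transports this onto the given frame read in
`𝓞_{ℂ₃}⟦T⟧`: `‖[T⁰]L'‖ = ‖V‖²`; (iv) `[T⁰]L'/V² ∈ Frac R₀` has norm one, hence is a unit of `R₀` (`R₀` is the valuation ring of
`Frac R₀`: `R1.mem_unrIntegers_of_mem_fracUnr`, `unrIntegers.isUnit_iff_norm_eq_one`) — the `u ∈ R₀ˣ` of `Three.BDPValueAt₃`.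
Steps (ii)–(iv) are the arguments of this lineage's `bdpValueAt₃_of_normContinuity` ∕ `bdpValueAt₃_iff_norm_constantCoeff`
(p429767 ∕ p425632, which live in Theses-importing modules) written out here so that the result is importable by a `closes`
certificate. CONDITIONAL on `X2.LZZRoadInputIoo` (typed input implied by the REFEREED fact, p515022); nothing booked; no count moves.
[cite: LiuZhangZhang2018, Thm. 1.5.1 and Remark 1.1.2 and Thm. 1.5.3 (Duke Math. J. 167 (2018) pp. 745–749) (source of the input)]
[cite: Castella2018, Thm. 3.1–3.2 (arXiv:1704.06608 pp. 8–9) (display and value shapes)] -/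
theorem bdpValueAt₃_of_lzzRoadInputIoo (hL : X2.LZZRoadInputIoo)
    (W : WeierstrassCurve ℚ) [W.IsElliptic] [W.IsGloballyMinimal] : BDPValueAt₃ W := by
  unfold BDPValueAt₃
  intro N _ K _ _ Dt H ι P hX _hsurj hN hK hodd hHN _hL1 hP hcM hP0 κ hκ γ hγ 𝔭 h𝔭 he hf f hfW ι' hι'
    ΩK' Ωp' L' hΩK' hL'
  have hp : (3 : ℕ).Prime := Fact.out
  have hmult : W.HasMultiplicativeReductionAtPrime 3 := hX.2.2.1
  -- (i) the bsd-eis rescale at this datum: `3 ∣ N`, `9 ∤ N`, `3` split in `K`, `3 ∤ d_K`, hence `d_K < -4`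
  have hpN : 3 ∣ N := hN ▸ X11b.dvd_conductorNorm_of_mult (W := W) hmult
  have hp2N : ¬ 3 ^ 2 ∣ N := hN ▸ X2.not_sq_dvd_conductorNorm_of_mult W 3 hmult
  have hsplit : ((Ideal.span {((3 : ℕ) : ℤ)}).primesOver (𝓞 K)).ncard = 2 := hHN 3 hp hpN
  have hdisc : ¬ ((3 : ℕ) : ℤ) ∣ NumberField.discr K :=
    Literature.SatisfiesHeegnerHypothesis.not_dvd_discr hK.1 hHN hp hpN
  have hneg : NumberField.discr K < 0 := IsImaginaryQuadratic.discr_neg hK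
  have hmod4 := Literature.NumberTheory.QuadraticFields.Quadratic.discr_emod_four (K := K) hK.1
  have hd4 : NumberField.discr K < -4 := by
    obtain ⟨m, hm⟩ := hodd
    have h3 : NumberField.discr K ≠ -3 := fun h ↦ hdisc ⟨-1, by rw [h]; norm_num⟩
    omega
  have hemb : ∀ k : 𝓞 K, k ∈ 𝔭.asIdeal ↔ ‖embAt K 3 𝔭 h𝔭 he hf (k : K)‖ < 1 :=
    mem_asIdeal_iff_norm_embAt_lt_one 𝔭 h𝔭 he hf
  obtain ⟨ΩK, Ωp, u, hΩK, hΩp, hu, hcont⟩ :=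
    X2.exists_continuousDisplay_of_lzzRoadInputIoo hL ι' W K 𝔭 κ γ Dt H ι (embAt K 3 𝔭 h𝔭 he hf) P f
      (by decide) hmult hN hpN hp2N hK hd4 hsplit h𝔭 hι' hHN hκ hγ.out hfW hcM hP hemb
  -- (ii) the NORMS of the displays tend to `‖V‖²`
  have hVN : ∀ (φ : ℕ → HeckeCharacter K) (n : ℕ → ℕ) (r : ℕ → FramedGaloisRep K (PadicAlgCl 3) 1),
      (∀ k, 0 < n k) → (∀ k (v : HeightOneSpectrum (𝓞 K)), (φ k).IsUnramifiedAt v) →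
      (∀ k, (φ k).HasInfinityType (fun _ ↦ (n k : ℤ)) (fun _ ↦ -(n k : ℤ))) →
      (∀ k, IsPAdicAvatarOf ι' (φ k) (r k)) → (∀ k, FactorsThroughZp κ (r k)) →
      Tendsto (fun k ↦ avatarValueAt (r k) γ) atTop (𝓝 1) →
      Tendsto (fun k ↦ ‖((ι'.symm (bdpInterpolationValue 3 f 𝔭 (φ k) (n k) ΩK) :
        PadicAlgCl 3) : ℂ_[3]) * Ωp ^ (4 * n k)‖) atTop
        (𝓝 (‖algebraMap ℚ_[3] ℂ_[3] (((1 : ℚ_[3]) - ((W.LFunction 3 : ℤ) : ℚ_[3]) *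
            (3 : ℚ_[3])⁻¹) * logOmega W 3 (embAt K 3 𝔭 h𝔭 he hf) P)‖ ^ 2)) := by
    intro φ n r hn hunr hinf hav hfac hlim
    have h := (hcont φ n r hn hunr hinf hav hfac hlim).norm
    rwa [norm_mul, hu, one_mul, norm_pow, ← R1.logOmega_eq_padicLogOmega] at h
  -- the target is non-zero: `a₃ = ±1`, `log_ω P ≠ 0`
  have ha : W.LFunction 3 = 1 ∨ W.LFunction 3 = -1 :=
    lFunction_eq_one_or_eq_neg_one_of_isNewformOf W hfW hX.2.2.1
  have hx : ((1 : ℚ_[3]) - ((W.LFunction 3 : ℤ) : ℚ_[3]) * (3 : ℚ_[3])⁻¹) *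
      logOmega W 3 (embAt K 3 𝔭 h𝔭 he hf) P ≠ 0 := by
    refine mul_ne_zero ?_ (R1.logOmega_ne_zero W 3 (embAt K 3 𝔭 h𝔭 he hf) hP0)
    rcases ha with ha | ha <;> rw [ha] <;> norm_num
  have hy0' : algebraMap ℚ_[3] ℂ_[3] (((1 : ℚ_[3]) - ((W.LFunction 3 : ℤ) : ℚ_[3]) * (3 : ℚ_[3])⁻¹) *
      logOmega W 3 (embAt K 3 𝔭 h𝔭 he hf) P) ≠ 0 :=
    (map_ne_zero_iff _ (algebraMap ℚ_[3] ℂ_[3]).injective).mpr hx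
  have hN0 : ‖algebraMap ℚ_[3] ℂ_[3] (((1 : ℚ_[3]) - ((W.LFunction 3 : ℤ) : ℚ_[3]) * (3 : ℚ_[3])⁻¹) *
      logOmega W 3 (embAt K 3 𝔭 h𝔭 he hf) P)‖ ^ 2 ≠ 0 :=
    pow_ne_zero _ (norm_ne_zero_iff.mpr hy0')
  -- (iii) one-sided norm rigidity onto the given frame, read in `𝓞_{ℂ₃}⟦T⟧`
  have hΩp' : ((Ωp' : unrIntegers 3) : ℂ_[3]) ≠ 0 := by
    rw [Ne, ZeroMemClass.coe_eq_zero]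
    exact Units.ne_zero Ωp'
  have hQ' := R1.isBDPLFunctionInt_map hL'
  have key := intSeries_norm_constantCoeff_eq_of_isBDPLFunctionInt_of_continuousNorms (p := 3) (by decide)
    hK hκ hγ.out hΩK hΩK' hΩp hΩp' hVN hN0 hQ'
  have hcoe : ((PowerSeries.constantCoeff (PowerSeries.map (R1.unrToCpInt 3) L') : 𝓞_ℂ_[3]) : ℂ_[3]) =
      ((PowerSeries.constantCoeff L' : unrIntegers 3) : ℂ_[3]) := by
    rw [← PowerSeries.coeff_zero_eq_constantCoeff_apply, PowerSeries.coeff_map,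
      PowerSeries.coeff_zero_eq_constantCoeff_apply, R1.coe_unrToCpInt]
  rw [hcoe] at key
  -- (iv) `[T⁰]L' / V² ∈ Frac R₀` has norm one, hence is a unit of `R₀`
  set a : ℂ_[3] := ((PowerSeries.constantCoeff L' : unrIntegers 3) : ℂ_[3]) with ha'
  set y : ℂ_[3] := (algebraMap ℚ_[3] ℂ_[3] (((1 : ℚ_[3]) - ((W.LFunction 3 : ℤ) : ℚ_[3]) * (3 : ℚ_[3])⁻¹) *
      logOmega W 3 (embAt K 3 𝔭 h𝔭 he hf) P)) ^ 2 with hy'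
  have hnorm : ‖a‖ = ‖y‖ := by rw [hy', norm_pow]; exact key
  have hy0 : y ≠ 0 := pow_ne_zero _ hy0'
  have hyF : y ∈ Subfield.closure (unrIntegers 3 : Set ℂ_[3]) := by
    refine pow_mem ?_ 2
    rw [IsScalarTower.algebraMap_apply ℚ_[3] (PadicAlgCl 3) ℂ_[3]]
    exact PadicComplexTransport.algebraMap_padic_mem_fracUnr 3 _
  have hw : a / y ∈ Subfield.closure (unrIntegers 3 : Set ℂ_[3]) :=
    div_mem (Subfield.subset_closure (PowerSeries.constantCoeff L').2) hyF
  have hw1 : ‖a / y‖ = 1 := by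
    rw [norm_div, hnorm, div_self (norm_ne_zero_iff.mpr hy0)]
  have hwR : a / y ∈ unrIntegers 3 := R1.mem_unrIntegers_of_mem_fracUnr hw hw1.le
  obtain ⟨u', hu'⟩ := (unrIntegers.isUnit_iff_norm_eq_one ⟨a / y, hwR⟩).mpr hw1
  refine ⟨u', ?_⟩
  have huy : ((u' : unrIntegers 3) : ℂ_[3]) * y = a := by
    rw [hu']
    exact div_mul_cancel₀ a hy0
  rw [huy]
  exact L'.hasValueAt_zero

/-! ## §2 The same from the REFEREED fact -/

/-- **`Three.BDPValueAt₃ W` for every globally minimal `W`, from the REFEREED Liu–Zhang–Zhang fact** (Duke 167 Thm. 1.5.1 +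
Remark 1.1.2 ∧ Thm. 1.5.3 at `p ∣ N`, `p² ∤ N`, `p` split; typed p509230) through bsd-eis's `X2.lzzRoadInputIoo_of_thm151_thm153`
(p515022): the H2 half of O2@3 ∕ B10 for every X11b@3 class rests on ONE published named fact and kernel theorems — the
kernel replacement of the memo road THEOREM C (PROOF-BDP §20) for this half. A `conditional-result`; nothing booked; no
label or count moves. [cite: LiuZhangZhang2018, Thm. 1.5.1 and Remark 1.1.2 and Thm. 1.5.3 (Duke Math. J. 167 (2018) pp. 745–749)] -/
theorem bdpValueAt₃_of_thm151_thm153 (hF : LiuZhangZhang2018.thm151_thm153_modularCurve_heegnerVector)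
    (W : WeierstrassCurve ℚ) [W.IsElliptic] [W.IsGloballyMinimal] : BDPValueAt₃ W :=
  bdpValueAt₃_of_lzzRoadInputIoo (X2.lzzRoadInputIoo_of_thm151_thm153 hF) W

/-! ## §3 The BODIES of the re-oriented halves cruxes 20194 ∕ 20253 from the fact and the H3ᴮ bodies (Theses-free) -/

/-- **The body of `ClassRecordThree.HalvesAtThreeR` (item 20194, K2@3 `closes` binder h₂) ⟸ the REFEREED LZZ fact ∧ the body
of `ClassRecordThree.IMCDivTwoLociAtThreeR` (item 20262 = registered stub `stub_imcDivTwoLociAtThreeR` VERBATIM)**: H2 on both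
loci is §3, H3ᴮ is passed through. Theses-free (usable inside a `closes` re-certification; one `fun W _ _ hX ↦ … W hX` away
from the route decl). CONDITIONAL on `hF` (named fact) and `h3` (OPEN crux); nothing booked; no count moves.
[cite: LiuZhangZhang2018, Thm. 1.5.1 and Remark 1.1.2 and Thm. 1.5.3 (Duke Math. J. 167 (2018) pp. 745–749)]
[cite: Castella2018, Thm. 3.3 (arXiv:1704.06608 p. 9) (shape of H3 only; open at p = 3)] -/
theorem halvesAtThreeRBody_of_thm151_thm153_of_imcDivTwoLociRBody
    (hF : LiuZhangZhang2018.thm151_thm153_modularCurve_heegnerVector)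
    (h3 : ∀ (W : WeierstrassCurve ℚ) [W.IsElliptic] [W.IsGloballyMinimal], ClassX11b W 3 →
      (Ram W 3 → W.HasSplitMultiplicativeReductionAtPrime 3 → IMCDivAt₃B W) ∧
        (¬ Ram W 3 → Surj W 3 → IMCDivAt₃B W)) :
    ∀ (W : WeierstrassCurve ℚ) [W.IsElliptic] [W.IsGloballyMinimal], ClassX11b W 3 →
      (Ram W 3 → W.HasSplitMultiplicativeReductionAtPrime 3 → BDPValueAt₃ W ∧ IMCDivAt₃B W) ∧
        (¬ Ram W 3 → Surj W 3 → BDPValueAt₃ W ∧ IMCDivAt₃B W) := by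
  intro W _ _ hX
  obtain ⟨hI₁, hI₂⟩ := h3 W hX
  exact ⟨fun hr hs ↦ ⟨bdpValueAt₃_of_thm151_thm153 hF W, hI₁ hr hs⟩,
    fun hnr hsu ↦ ⟨bdpValueAt₃_of_thm151_thm153 hF W, hI₂ hnr hsu⟩⟩

/-- **The body of `KolyvaginRoadThree.HalvesTamAtThreeR` (item 20253, KOLY `closes` binder h₃) ⟸ the REFEREED LZZ fact ∧ the
body of `KolyvaginRoadThree.IMCDivTwoLociTamAtThreeR` (item 20263 = registered stub `stub_imcDivTwoLociTamAtThreeR` VERBATIM;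
the (ram) locus carries `3 ∣ ∏c`)**. Theses-free; CONDITIONAL on `hF` and `h3`; nothing booked.
[cite: LiuZhangZhang2018, Thm. 1.5.1 and Remark 1.1.2 and Thm. 1.5.3 (Duke Math. J. 167 (2018) pp. 745–749)]
[cite: Castella2018, Thm. 3.3 (arXiv:1704.06608 p. 9) (shape of H3 only; open at p = 3)] -/
theorem halvesTamAtThreeRBody_of_thm151_thm153_of_imcDivTwoLociTamRBody
    (hF : LiuZhangZhang2018.thm151_thm153_modularCurve_heegnerVector)
    (h3 : ∀ (W : WeierstrassCurve ℚ) [W.IsElliptic] [W.IsGloballyMinimal], ClassX11b W 3 →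
      (Ram W 3 → W.HasSplitMultiplicativeReductionAtPrime 3 → 3 ∣ W.tamagawaProduct → IMCDivAt₃B W) ∧
        (¬ Ram W 3 → Surj W 3 → IMCDivAt₃B W)) :
    ∀ (W : WeierstrassCurve ℚ) [W.IsElliptic] [W.IsGloballyMinimal], ClassX11b W 3 →
      (Ram W 3 → W.HasSplitMultiplicativeReductionAtPrime 3 → 3 ∣ W.tamagawaProduct →
          BDPValueAt₃ W ∧ IMCDivAt₃B W) ∧
        (¬ Ram W 3 → Surj W 3 → BDPValueAt₃ W ∧ IMCDivAt₃B W) := by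
  intro W _ _ hX
  obtain ⟨hI₁, hI₂⟩ := h3 W hX
  exact ⟨fun hr hs ht ↦ ⟨bdpValueAt₃_of_thm151_thm153 hF W, hI₁ hr hs ht⟩,
    fun hnr hsu ↦ ⟨bdpValueAt₃_of_thm151_thm153 hF W, hI₂ hnr hsu⟩⟩

/-- **The same two bodies over the typed input `X2.LZZRoadInputIoo` instead of the fact** (for a planner who prefers to item-state
the INPUT rather than the fact): `HalvesAtThreeR`-body ⟸ input ∧ H3ᴮ-body. CONDITIONAL on both. [cite: LiuZhangZhang2018, Thm. 1.5.1 and Thm. 1.5.3 (Duke 167 pp. 748–749)] -/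
theorem halvesAtThreeRBody_of_lzzRoadInputIoo_of_imcDivTwoLociRBody (hL : X2.LZZRoadInputIoo)
    (h3 : ∀ (W : WeierstrassCurve ℚ) [W.IsElliptic] [W.IsGloballyMinimal], ClassX11b W 3 →
      (Ram W 3 → W.HasSplitMultiplicativeReductionAtPrime 3 → IMCDivAt₃B W) ∧
        (¬ Ram W 3 → Surj W 3 → IMCDivAt₃B W)) :
    ∀ (W : WeierstrassCurve ℚ) [W.IsElliptic] [W.IsGloballyMinimal], ClassX11b W 3 →
      (Ram W 3 → W.HasSplitMultiplicativeReductionAtPrime 3 → BDPValueAt₃ W ∧ IMCDivAt₃B W) ∧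
        (¬ Ram W 3 → Surj W 3 → BDPValueAt₃ W ∧ IMCDivAt₃B W) := by
  intro W _ _ hX
  obtain ⟨hI₁, hI₂⟩ := h3 W hX
  exact ⟨fun hr hs ↦ ⟨bdpValueAt₃_of_lzzRoadInputIoo hL W, hI₁ hr hs⟩,
    fun hnr hsu ↦ ⟨bdpValueAt₃_of_lzzRoadInputIoo hL W, hI₂ hnr hsu⟩⟩

end Summit.BirchSwinnertonDyer.BirchSwinnertonDyer.Theorems.LZZKernel

/-! ## §4 (appended) The planner's wanted signature, by name (plan g32 RULING 18 (B)) -/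

namespace Summit.BirchSwinnertonDyer.BirchSwinnertonDyer.Theorems

/-- **`bdpValueAt₃_all_of_thm151_thm153`** — the exact Theses-free signature asked for in plan g32 RULING 18 (B) («LZZ DOWN»
window input): the REFEREED Liu–Zhang–Zhang fact ⟹ `Three.BDPValueAt₃ W` for every X11b@3 curve. One line over
`LZZKernel.bdpValueAt₃_of_thm151_thm153` (the `ClassX11b` premise is not even needed — it sits inside the predicate — and is
accepted only to match the wanted shape). CONDITIONAL on the named fact (`conditional-result`); nothing booked; no count moves.
[cite: LiuZhangZhang2018, Thm. 1.5.1 and Remark 1.1.2 and Thm. 1.5.3 (Duke Math. J. 167 (2018) pp. 745–749)] -/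
theorem bdpValueAt₃_all_of_thm151_thm153
    (hF : LiuZhangZhang2018.thm151_thm153_modularCurve_heegnerVector) :
    ∀ (W : WeierstrassCurve ℚ) [W.IsElliptic] [W.IsGloballyMinimal],
      Summit.BirchSwinnertonDyer.Rank1Residual.ClassX11b W 3 →
        Summit.BirchSwinnertonDyer.Rank1Residual.X11b.Three.BDPValueAt₃ W :=
  fun W _ _ _ ↦ LZZKernel.bdpValueAt₃_of_thm151_thm153 hF W

end Summit.BirchSwinnertonDyer.BirchSwinnertonDyer.Theorems

end
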